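/- Free-seat work of EXTRA WIDTH SEAT `ym-line-cbag-p1-w4` (prover-ym-line-cbag-p1-w4-g2-0), route `EguchiKawaiDirectionLadder`
(ideator ym-idea-2, LINE 8), crux `TripleSmallBallMargin` (stmt-QuantumFields-27724): CAPSTONE v3 of stub S9 «Abs» of the LEAD's v7
architecture (ARCH-27724-lead-g24 §3(ii)–(iii)) meeting the assembly contract F1–F4 (STATUS 15:02–15:19Z): one decoupling level with
(F1) far-mass slack LINEAR in the off-block masses and (F4) a GENERIC extra block-local event `G` (the within-block rigidity branch);
the composed form with per-block factor `min{ρ_c², ψ_c}` (F2/F3, over the LEAD's `blockPairFibre_le_min`) is the sequel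
`…BlockDecouplingMin`.  ROUTE-INDEPENDENT.  Nothing here bears on the Yang–Mills mass gap. -/
import Summits.QuantumFields.YangMills.Theorems.EguchiKawaiDirectionLadderBlockPairLaw
import Summits.QuantumFields.YangMills.Theorems.EguchiKawaiDirectionLadderBlockPairCrossLinear
import HarnessLib

/-!
# Route `EguchiKawaiDirectionLadder`: one decoupling level, linear far slack and a generic extra block event (S9 capstone v3, part 1)

Setting: a labelling `ℓ : Fin N → Fin m`, a set `T` of blocks to decouple, a collar set `near` of labels (`q := Σ_{a∈near} #{ℓ=a}`),
a measurable pair event `E ⊆ U(N) × U(N)`, off-block sets `A₁, A₂ ⊆ U(N)`; `ι(D)` = block-diagonal unitary with blocks `D`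
(`= 1` off `T`).  Hypotheses (shared with the sequel `…BlockDecouplingMin`): (h_off) `(X·ι(D), Y·ι(D′)) ∈ E ⇒ X ∈ A₁, Y ∈ A₂`; (h_block) on `E` every
diagonal block `c ∈ T` of the commutator has Frobenius² `≤ s`; (h_far) for `X ∈ A₁, Y ∈ A₂`, `c ∈ T`:
`2·#far·Σ_{a far}(Σ|X_{ca}|² + Σ|Y_{ca}|²) ≤ Φ` — LINEAR (F1).

* `haar_prod_le_prod_blockEvent_mul_linear` (F4, generic): for ANY extra block-local events `G c X Y ⊆ U_c × U_c` with (h_G) «on `E`,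
  `(D_c, D′_c) ∈ G c X Y` for `c ∈ T`», and (h_p) `Haar_c²(G c X Y ∩ COMM_c(X,Y)) ≤ p c` for `X ∈ A₁, Y ∈ A₂`, where
  `COMM_c(X,Y) = {(V₁,V₂) : ∃ J, rk J ≤ 2q, Σ|X_{cc}V₁Y_{cc}V₂ − Y_{cc}V₂X_{cc}V₁ − J|² ≤ 2s + 2Φ}`:
  `Haar²(E) ≤ (∏_{c∈T} p c) · Haar²(A₁ ×ˢ A₂)`.
* the composed form `haar_prod_le_prod_min_mul` (RIG ∧ COMM, factor `min{ρ_c², ψ_c}`) is in `…BlockDecouplingMin`.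

Assembly of: `haar_prod_le_prod_mul_of_blockPair_fibres` (…BlockPairLaw) and `blockLocal_robustPair_of_commutatorBlock_small_linear`
(…BlockPairCrossLinear).

HONEST FRAMING: bookkeeping; the per-block bounds `p c` and `Haar²(A₁ ×ˢ A₂)` are hypotheses.  The route bears on the
barrier-ledger fact `EguchiKawaiBreakdown` only.
-/

set_option autoImplicit false

noncomputable section

open MeasureTheory
open scoped Matrix ENNReal Matrix.Norms.L2Operator
open Literature.Barriers.QuantumFields

namespace Summit.QuantumFields.YangMills.Theorems.EguchiKawaiDirectionLadder

variable {N m : ℕ}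

/-- **ONE DECOUPLING LEVEL with a generic extra block-local event (F1 + F4).**  See the module docstring. -/
theorem haar_prod_le_prod_blockEvent_mul_linear (ℓ : Fin N → Fin m) (T near : Finset (Fin m)) {E : Set (UN N × UN N)}
    (hE : MeasurableSet E) (A₁ A₂ : Set (UN N)) {s Φ : ℝ}
    (G : (c : Fin m) → UN N → UN N →
      Set (Matrix.unitaryGroup {i : Fin N // ℓ i = c} ℂ × Matrix.unitaryGroup {i : Fin N // ℓ i = c} ℂ))
    (p : Fin m → ℝ≥0∞)
    (h_off : ∀ (X Y : UN N) (W : BlockUnitaryPairs ℓ),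
      (X * blockDiagUnitary ℓ (fstOn T W), Y * blockDiagUnitary ℓ (sndOn T W)) ∈ E → X ∈ A₁ ∧ Y ∈ A₂)
    (h_block : ∀ (X Y : UN N) (W : BlockUnitaryPairs ℓ),
      (X * blockDiagUnitary ℓ (fstOn T W), Y * blockDiagUnitary ℓ (sndOn T W)) ∈ E → ∀ c ∈ T,
        ∑ i, ∑ j, ‖((X : Matrix (Fin N) (Fin N) ℂ) *
              blockDiag ℓ (fun a => (fstOn T W a : Matrix {i : Fin N // ℓ i = a} {i : Fin N // ℓ i = a} ℂ)) *
            ((Y : Matrix (Fin N) (Fin N) ℂ) *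
              blockDiag ℓ (fun a => (sndOn T W a : Matrix {i : Fin N // ℓ i = a} {i : Fin N // ℓ i = a} ℂ))) -
          (Y : Matrix (Fin N) (Fin N) ℂ) *
              blockDiag ℓ (fun a => (sndOn T W a : Matrix {i : Fin N // ℓ i = a} {i : Fin N // ℓ i = a} ℂ)) *
            ((X : Matrix (Fin N) (Fin N) ℂ) *
              blockDiag ℓ (fun a => (fstOn T W a : Matrix {i : Fin N // ℓ i = a} {i : Fin N // ℓ i = a} ℂ)))).toBlock
            (fun i => ℓ i = c) (fun i => ℓ i = c) i j‖ ^ 2 ≤ s)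
    (h_G : ∀ (X Y : UN N) (W : BlockUnitaryPairs ℓ),
      (X * blockDiagUnitary ℓ (fstOn T W), Y * blockDiagUnitary ℓ (sndOn T W)) ∈ E → ∀ c ∈ T, W c ∈ G c X Y)
    (h_far : ∀ X ∈ A₁, ∀ Y ∈ A₂, ∀ c ∈ T,
      2 * ((Finset.univ.erase c).filter (fun a => a ∉ near)).card *
        ∑ a ∈ (Finset.univ.erase c).filter (fun a => a ∉ near),
          ((∑ i, ∑ j, ‖(X : Matrix (Fin N) (Fin N) ℂ).toBlock (fun i => ℓ i = c) (fun i => ℓ i = a) i j‖ ^ 2) +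
            ∑ i, ∑ j, ‖(Y : Matrix (Fin N) (Fin N) ℂ).toBlock (fun i => ℓ i = c) (fun i => ℓ i = a) i j‖ ^ 2) ≤ Φ)
    (h_p : ∀ X ∈ A₁, ∀ Y ∈ A₂, ∀ c ∈ T,
      (Literature.MathematicalPhysics.QuantumFieldTheory.haarProbability (Matrix.unitaryGroup {i : Fin N // ℓ i = c} ℂ)).prod
        (Literature.MathematicalPhysics.QuantumFieldTheory.haarProbability (Matrix.unitaryGroup {i : Fin N // ℓ i = c} ℂ))
        (G c X Y ∩ {V | ∃ J : Matrix {i : Fin N // ℓ i = c} {i : Fin N // ℓ i = c} ℂ,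
          J.rank ≤ 2 * ∑ a ∈ near, Fintype.card {i : Fin N // ℓ i = a} ∧
          ∑ i, ∑ j, ‖((X : Matrix (Fin N) (Fin N) ℂ).toBlock (fun i => ℓ i = c) (fun i => ℓ i = c) *
                (V.1 : Matrix {i : Fin N // ℓ i = c} {i : Fin N // ℓ i = c} ℂ) *
              ((Y : Matrix (Fin N) (Fin N) ℂ).toBlock (fun i => ℓ i = c) (fun i => ℓ i = c) *
                (V.2 : Matrix {i : Fin N // ℓ i = c} {i : Fin N // ℓ i = c} ℂ)) -
              (Y : Matrix (Fin N) (Fin N) ℂ).toBlock (fun i => ℓ i = c) (fun i => ℓ i = c) *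
                (V.2 : Matrix {i : Fin N // ℓ i = c} {i : Fin N // ℓ i = c} ℂ) *
              ((X : Matrix (Fin N) (Fin N) ℂ).toBlock (fun i => ℓ i = c) (fun i => ℓ i = c) *
                (V.1 : Matrix {i : Fin N // ℓ i = c} {i : Fin N // ℓ i = c} ℂ)) - J) i j‖ ^ 2 ≤ 2 * s + 2 * Φ}) ≤ p c) :
    (Literature.MathematicalPhysics.QuantumFieldTheory.haarProbability (UN N)).prod
        (Literature.MathematicalPhysics.QuantumFieldTheory.haarProbability (UN N)) E ≤
      (∏ c ∈ T, p c) *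
        (Literature.MathematicalPhysics.QuantumFieldTheory.haarProbability (UN N)).prod
          (Literature.MathematicalPhysics.QuantumFieldTheory.haarProbability (UN N)) (A₁ ×ˢ A₂) := by
  classical
  refine haar_prod_le_prod_mul_of_blockPair_fibres ℓ T hE A₁ A₂
    (fun c X Y => G c X Y ∩ {V | ∃ J : Matrix {i : Fin N // ℓ i = c} {i : Fin N // ℓ i = c} ℂ,
      J.rank ≤ 2 * ∑ a ∈ near, Fintype.card {i : Fin N // ℓ i = a} ∧
      ∑ i, ∑ j, ‖((X : Matrix (Fin N) (Fin N) ℂ).toBlock (fun i => ℓ i = c) (fun i => ℓ i = c) *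
            (V.1 : Matrix {i : Fin N // ℓ i = c} {i : Fin N // ℓ i = c} ℂ) *
          ((Y : Matrix (Fin N) (Fin N) ℂ).toBlock (fun i => ℓ i = c) (fun i => ℓ i = c) *
            (V.2 : Matrix {i : Fin N // ℓ i = c} {i : Fin N // ℓ i = c} ℂ)) -
          (Y : Matrix (Fin N) (Fin N) ℂ).toBlock (fun i => ℓ i = c) (fun i => ℓ i = c) *
            (V.2 : Matrix {i : Fin N // ℓ i = c} {i : Fin N // ℓ i = c} ℂ) *
          ((X : Matrix (Fin N) (Fin N) ℂ).toBlock (fun i => ℓ i = c) (fun i => ℓ i = c) *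
            (V.1 : Matrix {i : Fin N // ℓ i = c} {i : Fin N // ℓ i = c} ℂ)) - J) i j‖ ^ 2 ≤ 2 * s + 2 * Φ}) p ?_ h_p
  -- h1: off-block membership, the extra event, and the block-local commutator event
  intro X Y W hW
  obtain ⟨hX, hY⟩ := h_off X Y W hW
  refine ⟨hX, hY, fun c hc => ⟨h_G X Y W hW c hc, ?_⟩⟩
  have hs := h_block X Y W hW c hc
  obtain ⟨J', hJ', hJ's⟩ := blockLocal_robustPair_of_commutatorBlock_small_linear ℓ X Y (fstOn T W) (sndOn T W) c near hs
  have hfarXY := h_far X hX Y hY c hc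
  refine ⟨J', hJ', ?_⟩
  have hwp : withinPair ℓ (X : Matrix (Fin N) (Fin N) ℂ) (Y : Matrix (Fin N) (Fin N) ℂ) (fstOn T W) (sndOn T W) c =
      (X : Matrix (Fin N) (Fin N) ℂ).toBlock (fun i => ℓ i = c) (fun i => ℓ i = c) *
          ((W c).1 : Matrix {i : Fin N // ℓ i = c} {i : Fin N // ℓ i = c} ℂ) *
        ((Y : Matrix (Fin N) (Fin N) ℂ).toBlock (fun i => ℓ i = c) (fun i => ℓ i = c) *
          ((W c).2 : Matrix {i : Fin N // ℓ i = c} {i : Fin N // ℓ i = c} ℂ)) -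
        (Y : Matrix (Fin N) (Fin N) ℂ).toBlock (fun i => ℓ i = c) (fun i => ℓ i = c) *
          ((W c).2 : Matrix {i : Fin N // ℓ i = c} {i : Fin N // ℓ i = c} ℂ) *
        ((X : Matrix (Fin N) (Fin N) ℂ).toBlock (fun i => ℓ i = c) (fun i => ℓ i = c) *
          ((W c).1 : Matrix {i : Fin N // ℓ i = c} {i : Fin N // ℓ i = c} ℂ)) := by
    unfold withinPair crossTerm
    rw [fstOn_of_mem W hc, sndOn_of_mem W hc]
  rw [hwp] at hJ's
  linarith

end Summit.QuantumFields.YangMills.Theorems.EguchiKawaiDirectionLadder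

end
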